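import Summits.QuantumFields.YangMills.Theorems.BalabanUVNodesK3V6StubsLetterForm

/-!
# K3⁸ v6 — the REGISTERED STUB 1 TEXT `stub_rates13HV` (skeleton b4e55110ab73e679) FROM NODE N16's PRODUCER OUTPUT + THE ROWS, and FROM NODE N05's `h5` + leaf-06's [B11]
# THEOREM-1 READING + THE ROWS — gen 3's `stub1Text_of_n16Producer_of_rows` ∕ `stub1Text_of_h5_thm1At_of_rows` (p608315 §4∕§6) RE-KEYED AT THE VERSION SLOT

Cell `pub-ymgap` (HUMAN RULING D-0062 Track A; director-ym №210 (δⱽ); dag-lead KEY MAP v2), WIDTH SEAT `pub-ymgap-dag-n27-w1` (gen 4) on NODE n27 (B5 composite).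
`--kind proof --supports stmt-QuantumFields-27366 --as helper` (count-neutral).  THEOREMS ONLY, 0 `def`, 0 `sorry`, standard axioms; `N = 2`.
Sequel of `…K3V6StubsLetterForm` (p629121 §4: the (B)-free bill `keyedRatesHolderD4BFree_rrOfRecord_of_pins_of_letters`, its slot edition, `stub1TextV_of_rows`).

WHY.  The slot is FREE on the rows road to stub 1 (p629121 §4): the bill never reads (B) ∕ END, so `KeyedRatesHolderD4V` follows by `K3V6Defs.keyedRatesHolderD4V_of_bFree`.  Gen 3 had two
further producers of v5's stub-1 text — dag-n16-e's N16 producer OUTPUT SHAPE (`∃ ℓ₃ B, N16LettersEnd 2 g ℓ₃ ∧ (∀ F, 0 < B F ∧ (ℓ₃ F).ε / B F ≤ (ℓ₃ F).b) ∧ ∀ 𝔯, N16PinnedLoose 𝔯 ℓ₃ B →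
N16HolderAtReading 𝔯 β`) and, behind it, node N05's `h5` + leaf-06's [B11] Theorem-1 reading (`…N16PinnedLooseMatch.exists_letters_n16HolderAtReading_loose_of_h5_thm1At_match`).  THIS FILE
re-issues both for the v6 text: same `obtain`s, the v6 bill in place of gen 2's.

CONTENTS.  ★★ `stub1TextV_of_n16Producer_of_rows` · ★★ `stub1TextV_of_h5_thm1At_of_rows` · `spineGivenEndpointR13SepCoPHV_of_h5_thm1At_of_rows_of_stub2TextV` (K3⁸ BY NAME from those
in-edges + the REGISTERED `stub_expansion13HV` text).

HONEST FRAMING.  COMPOSITE-node bookkeeping BY NAME; NOT a proof of `stub_rates13HV` (hypothesis form: every in-edge — node N05's `h5` ([B8] Thm 4 ∕ Prop 3 bodies on the periodic data),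
[Balaban1985Variational] Thm 1 at leaf-06's torus instances, leaf-06's local-gauge interface, the U3 letter rows, def-W1's four finite-volume kernel letters NOT PRINTED as such for d = 4
((1.21)'s existence [Balaban1987RG1] p.264 NOT proved; (5.10) = p.293 before the limit), stub 2's text — is a DISPLAYED HYPOTHESIS inhabited ∕ asserted for no family today; K0⁷ OPEN);
nothing of Bałaban's asserted or instantiated; N05 ∕ N07 ∕ N16 ∕ N17 ∕ N18 ∕ N22 ∕ (D4) ∕ N27 NOT discharged; K3⁸ stmt-QuantumFields-27366 OPEN, NOT claimed; skeleton v6 UNTOUCHED; K3⁷ 20544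
aside; counts UNMOVED (typed 28∕28 · discharged 5∕27, A 5∕28).  One finite 𝕋⁴ programme at fixed `ε` — R4 closes the CONDITIONAL finite-𝕋⁴ rung `BalabanLadder.UV` only: NOT continuum ∕
ℝ⁴ ∕ OS ∕ mass gap ∕ Clay; the Yang–Mills mass gap is NOT proved by any of this.
-/

set_option autoImplicit false

noncomputable section

open scoped BigOperators Matrix Matrix.Norms.L2Operator

namespace Summit.QuantumFields.YangMills.Theorems.K3V6Defs

open NormedSpace
open Literature.MathematicalPhysics.QuantumFieldTheory.Balaban1983to89
open Literature.MathematicalPhysics.QuantumFieldTheory.Balaban1983to89.T4Continuum (T4Family ULoop)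
open Literature.MathematicalPhysics.QuantumFieldTheory.Balaban1983to89.B12Sec2to5 (betaPrime510)
open Literature.MathematicalPhysics.QuantumFieldTheory.Balaban1983to89.Node00.U3KernelLetters (PolLimitsExistOfRecord₁₃ WindowedNE9OfRecord₁₃ WindowedDecayOfRecord₁₃
  WindowedStepRateOfRecord₁₃)
open B7Prop1Explicit B7Prop2Explicit MatrixLog UnitaryModel
open T4AveragingDeficitWall hiding Site Plaq Bond
open B7Prop3Flat (c3)
open B8LeafModelZd (ZdIdx)
open B8LeafModelZd3 (zdGF3)
open Node00 (Stage13HParams NE3Objects₁₁ NE3Letters₁₁ ne3ConstLayerOfRecord₁₁ ne3NperOfRecord₁₁ ne3DomOfRecord₁₁ MatA)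
open Summit.QuantumFields.BalabanUV.T4Continuum
open MinimalActionRate (sfClass)
open MinimalActionDictionary (torusVP RadiiMono)
open AveragingDeficitLatticeH2Prep (fd)
open B11Thm1 (Thm1At)
open YMDAG.UVSplit (RateReading₁₃CoPH ShellSplit₁₃CoPH)
open Summit.QuantumFields.YangMills.BalabanUVNodes.N16HolderDefs (N16HolderAt)
open Summit.QuantumFields.YangMills.BalabanUVNodes.N16PinnedLayer13CoPH (N16PinnedLoose N16LettersEnd N16HolderAtReading n16HolderAtReading_iff_of_pinnedLoose)
open Summit.QuantumFields.YangMills.BalabanUVNodes.N16PinnedLooseMatch (exists_letters_n16HolderAtReading_loose_of_h5_thm1At_match)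
open Summit.QuantumFields.YangMills.Theorems.K3V5Defs

section Rows

variable (β : ℝ) (hβ : 2 / 3 < β) (hβ' : β < 1) (ℓ : LetterReading) (g : T4Family → ℝ) (s : (F : T4Family) → Stage13HParams F 2 → ℕ)
  -- the U3 letter block's rows
  (hs : ∀ (F : T4Family) (θ : Stage13HParams F 2), θ.Provisos₁₃CoPH F 2 → (θ.ZhUnity F 2 ∧ θ.SlotsNondegenerate₁₃ F 2) → θ.Admissible F 2 → (ℓ F θ).Signs)
  (hκ : ∀ (F : T4Family) (θ : Stage13HParams F 2), θ.Provisos₁₃CoPH F 2 → (θ.ZhUnity F 2 ∧ θ.SlotsNondegenerate₁₃ F 2) → θ.Admissible F 2 → 0 < (ℓ F θ).κ)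
  (hcr : ∀ (F : T4Family) (θ : Stage13HParams F 2), θ.Provisos₁₃CoPH F 2 → (θ.ZhUnity F 2 ∧ θ.SlotsNondegenerate₁₃ F 2) → θ.Admissible F 2 → betaPrime510 4 1 (ℓ F θ).κ ≤ (ℓ F θ).cr)
  (hρ : ∀ (F : T4Family) (θ : Stage13HParams F 2), θ.Provisos₁₃CoPH F 2 → (θ.ZhUnity F 2 ∧ θ.SlotsNondegenerate₁₃ F 2) → θ.Admissible F 2 → 0 ≤ (ℓ F θ).ρ ∧ (ℓ F θ).ρ < 1)
  -- def-W1's four finite-volume kernel letters of record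
  (hL : ∀ (F : T4Family) (θ : Stage13HParams F 2), θ.Provisos₁₃CoPH F 2 → (θ.ZhUnity F 2 ∧ θ.SlotsNondegenerate₁₃ F 2) → θ.Admissible F 2 → PolLimitsExistOfRecord₁₃ F 2 θ.toStage13Params)
  (h9 : ∀ (F : T4Family) (θ : Stage13HParams F 2), θ.Provisos₁₃CoPH F 2 → (θ.ZhUnity F 2 ∧ θ.SlotsNondegenerate₁₃ F 2) → θ.Admissible F 2 →
    WindowedNE9OfRecord₁₃ F 2 θ.toStage13Params (ℓ F θ).κ (ℓ F θ).moduli)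
  (hW : ∀ (F : T4Family) (θ : Stage13HParams F 2), θ.Provisos₁₃CoPH F 2 → (θ.ZhUnity F 2 ∧ θ.SlotsNondegenerate₁₃ F 2) → θ.Admissible F 2 →
    WindowedDecayOfRecord₁₃ F 2 θ.toStage13Params 0 1 (ℓ F θ).κ)
  (hS : ∀ (F : T4Family) (θ : Stage13HParams F 2), θ.Provisos₁₃CoPH F 2 → (θ.ZhUnity F 2 ∧ θ.SlotsNondegenerate₁₃ F 2) → θ.Admissible F 2 →
    WindowedStepRateOfRecord₁₃ F 2 θ.toStage13Params (s F θ) (ℓ F θ).κ (ℓ F θ).θ₅ ((ℓ F θ).C₅ * (ℓ F θ).θ₅))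
include hβ hβ' hs hκ hcr hρ hL h9 hW hS

/-- ★★ **v6 STUB 1's TEXT FROM NODE N16's PRODUCER OUTPUT AND THE ROWS** — gen 3's `stub1Text_of_n16Producer_of_rows` at the slot: the two N16 letter rows AND `h16` are replaced by the
OUTPUT SHAPE of dag-n16-e's producers (`∃ ℓ₃ B, N16LettersEnd 2 g ℓ₃ ∧ (∀ F, 0 < B F ∧ (ℓ₃ F).ε / B F ≤ (ℓ₃ F).b) ∧ ∀ 𝔯, N16PinnedLoose 𝔯 ℓ₃ B → N16HolderAtReading 𝔯 β`); `h16` is read off the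
producer at the minted reading through module 43's `n16HolderAtReading_iff_of_pinnedLoose`; the rates conjunct by p629121's slot bill.  NOT a proof of the stub. [bookkeeping] -/
theorem stub1TextV_of_n16Producer_of_rows
    (hN16 : ∃ (ℓ₃ : T4Family → NE3Letters₁₁) (B : T4Family → ℝ), N16LettersEnd 2 g ℓ₃ ∧ (∀ F : T4Family, 0 < B F ∧ (ℓ₃ F).ε / B F ≤ (ℓ₃ F).b) ∧
      ∀ 𝔯 : RateReading₁₃CoPH 2, N16PinnedLoose 𝔯 ℓ₃ B → N16HolderAtReading 𝔯 β) :
    ∃ β : ℝ, 2 / 3 < β ∧ β < 1 ∧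
    ∃ (𝔯 : RateReading₁₃CoPH 2) (ksel : RunSel) (ℓ : LetterReading) (ℓ₃ : T4Family → Node00.NE3Letters₁₁) (g B : T4Family → ℝ),
      GuardedReadingN16 𝔯 ksel ℓ ℓ₃ g B ∧ KeyedRatesHolderD4V β (rrOfRecord 𝔯 ksel) := by
  obtain ⟨ℓ₃', B', hE', hM', hH⟩ := hN16
  obtain ⟨𝔯, h1, h2, h3, hpL⟩ := exists_reading_v5pins 1 0 1 1 0 0 0 0 0 0 ℓ ℓ₃' B' one_pos le_rfl one_pos one_pos
  have hG : GuardedReadingN16 𝔯 (fun _ _ _ _ _ => 0) ℓ ℓ₃' g B' := (guardedReadingN16_iff_pins_letterRows _ ℓ ℓ₃' g B').2 ⟨⟨h1, h2, h3, hpL⟩, hE', hM'⟩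
  have h16 := (n16HolderAtReading_iff_of_pinnedLoose β hpL).1 (hH 𝔯 hpL)
  exact ⟨β, hβ, hβ', 𝔯, fun _ _ _ _ _ => 0, ℓ, ℓ₃', g, B', hG,
    keyedRatesHolderD4V_rrOfRecord_of_pins_of_letters 𝔯 (fun _ _ _ _ _ => 0) ℓ ℓ₃' g B' β s (fun F ⟨θ, hP, _, _⟩ => h16 F ⟨θ, hP⟩) hs hκ hcr hρ hL h9 hW hS hG⟩

/-- ★★ **v6 STUB 1's TEXT FROM NODE N05's `h5` AND THE [B11] THEOREM-1 READING, BY NAME** — gen 3's `stub1Text_of_h5_thm1At_of_rows` at the slot: the REGISTERED `stub_rates13HV` text from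
`β ∈ ]2/3, 1[`; a coupling letter `g F > 0`; node N05's `h5` (37ᴴ's binder VERBATIM — [B8] Thm 4 ∕ Prop 3 bodies on the `2L^m`-periodic data); leaf-06's local-gauge shape `G F` (`RadiiMono`,
the (9)_{β₀=1} interface `hG`), constants `C F : B11Thm1.Consts` with `M(ε₁) ≥ 7∕2` on `(0, a₁]`, and `hT : ∀ k, Thm1At (C F) (torusVP 4 F.L Nper (G F) (k+1))` ([Balaban1985Variational] Thm 1
for the torus instances — DISPLAYED, asserted for nothing); the U3 letter rows; def-W1's four finite-volume kernel letters.  ONE `obtain` on dag-n16-e's producer, then the theorem above.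
THE VERSION SLOT COSTS NOTHING on this road.  Every in-edge a displayed HYPOTHESIS; NOT a proof of the stub; N05 ∕ N07 ∕ N16 ∕ N17 ∕ N18 ∕ N22 ∕ (D4) NOT discharged. [bookkeeping] -/
theorem stub1TextV_of_h5_thm1At_of_rows (hg : ∀ F, 0 < g F)
    (h5 : ∀ F : T4Family, letI : CStarAlgebra (Matrix (Fin 2) (Fin 2) ℂ) := {}
      ∃ (len : Site 4 → ℝ) (c₁ c₁' B₁' cP C₂ B₀β : ℝ) (inp : B8.B9Inputs),
        (∀ v : Site 4, 0 < len v → 1 ≤ len v) ∧ (∀ μ : Fin 4, len (e μ) = 1) ∧ 0 < B₁' ∧ 5 * ((4 : ℕ) : ℝ) * F.L * inp.B₀ ≤ B₁' ∧ 0 < c₁' ∧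
        (∀ α₀ α₁ : ℝ, 0 < α₀ → 0 < α₁ → α₀ + α₁ ≤ c₁' →
          α₀ + α₁ ≤ c₁ ∧ C0 4 * (2 * α₀) ≤ 1 / 3 ∧ 4 * α₀ ≤ c2' 4 F.L ∧ 16 * (B₁' * (α₀ + α₁)) ≤ 1 ∧
          Real.exp (4 * (800 * (((4 : ℕ) : ℝ) + 1) ^ 2 * (((4 : ℕ) : ℝ) + 4)) * α₀) * (1 + 8 * (131072 * (((4 : ℕ) : ℝ) + 1) ^ 2) * (B₁' * (α₀ + α₁))) ≤ 2 ∧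
          2 * (B₁' * (α₀ + α₁)) ≤ c3 4 F.L ∧ ((4 : ℕ) : ℝ) * F.L * α₁ ≤ 1 / 8 ∧ α₀ ≤ cP ∧ α₁ ≤ cP ∧ B₁' * (α₀ + α₁) ≤ cP ∧
          2 * (B₁' * (α₀ + α₁)) ^ 2 + 20 * ((4 : ℕ) : ℝ) * α₀ * (B₁' * (α₀ + α₁)) + 2 * C₂ * (B₁' * (α₀ + α₁)) ^ 2 ≤ α₀ + α₁) ∧
        B8.Thm4Body c₁ B₁' (fun i : {i : ZdIdx 4 F.L // (∀ j, i.Ω j = Set.univ) ∧ (∀ m j, i.Λs m j = {_y | j = m}) ∧ (∀ m j, i.Λb m j = {_c | j = m}) ∧ i.η = ((F.L : ℝ)⁻¹) ^ i.k} => (zdGF3 (Matrix (Fin 2) (Fin 2) ℂ) F.L β len i.1).toGFData) ∧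
        B8.Prop3Body cP 4 (F.L : ℝ) C₂ inp B₀β (fun i : {i : ZdIdx 4 F.L // (∀ j, i.Ω j = Set.univ) ∧ (∀ m j, i.Λs m j = {_y | j = m}) ∧ (∀ m j, i.Λb m j = {_c | j = m}) ∧ i.η = ((F.L : ℝ)⁻¹) ^ i.k} => (zdGF3 (Matrix (Fin 2) (Fin 2) ℂ) F.L β len i.1).toGFData2))
    {G : T4Family → (Site 4 → Fin 4 → (MatA 2)ˣ) → Site 4 → ℕ → ℝ → ℝ → ℝ → Prop} (hGm : ∀ F, RadiiMono 4 (G F))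
    (hG : ∀ (F : T4Family) (U : Site 4 → Fin 4 → (MatA 2)ˣ) (x : Site 4) (K : ℕ) (α₀ α₁ α₂ : ℝ), 2 ≤ K → G F U x K α₀ α₁ α₂ →
      ∃ (u : Site 4 → (MatA 2)ˣ) (a : Site 4 → Fin 4 → MatA 2),
        (∀ z, u z ∈ unitaryUnits (MatA 2)) ∧
        (∀ (y : Site 4) (τ : Fin 4), l1 (y - x) ≤ 2 → ((gaugeAct u U y τ : (MatA 2)ˣ) : MatA 2) = exp (a y τ)) ∧
        (∀ (y : Site 4) (τ : Fin 4), l1 (y - x) ≤ 2 → ‖a y τ‖ ≤ α₀) ∧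
        (∀ (y : Site 4) (τ i : Fin 4), l1 (y - x) ≤ 1 → ‖fd i (fun z => a z τ) y‖ ≤ α₁) ∧
        (∀ (τ i l : Fin 4), ‖fd i (fd l (fun z => a z τ)) x‖ ≤ α₂))
    (C : T4Family → B11Thm1.Consts) (hM : ∀ (F : T4Family) (e : ℝ), 0 < e → e ≤ (C F).a₁ → 7 / 2 ≤ (C F).Mfun e)
    (hT : ∀ (F : T4Family) (k : ℕ), Thm1At (C F) (torusVP 4 F.L (ne3NperOfRecord₁₁ F 0 0) (G F) (k + 1))) :
    ∃ β : ℝ, 2 / 3 < β ∧ β < 1 ∧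
    ∃ (𝔯 : RateReading₁₃CoPH 2) (ksel : RunSel) (ℓ : LetterReading) (ℓ₃ : T4Family → Node00.NE3Letters₁₁) (g B : T4Family → ℝ),
      GuardedReadingN16 𝔯 ksel ℓ ℓ₃ g B ∧ KeyedRatesHolderD4V β (rrOfRecord 𝔯 ksel) := by
  have hβ0 : 0 ≤ β := by linarith
  obtain ⟨ℓ₃, B, hE, hM', -, hH⟩ := exists_letters_n16HolderAtReading_loose_of_h5_thm1At_match (N := 2) hβ0 hβ'.le hg h5 hGm hG C hM hT
  exact stub1TextV_of_n16Producer_of_rows β hβ hβ' ℓ g s hs hκ hcr hρ hL h9 hW hS ⟨ℓ₃, B, hE, hM', hH⟩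

/-- **K3⁸ BY NAME FROM NODE N05's `h5` + THE THEOREM-1 READING + THE ROWS, AND v6 STUB 2's TEXT** (`K3V6Defs.spineGivenEndpointR13SepCoPHV_of_stubTextsV` ∘ `stub1TextV_of_h5_thm1At_of_rows`).
Every in-edge a HYPOTHESIS; NOT a proof of either stub; K3⁸ OPEN. [bookkeeping] -/
theorem spineGivenEndpointR13SepCoPHV_of_h5_thm1At_of_rows_of_stub2TextV (hg : ∀ F, 0 < g F)
    (h5 : ∀ F : T4Family, letI : CStarAlgebra (Matrix (Fin 2) (Fin 2) ℂ) := {}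
      ∃ (len : Site 4 → ℝ) (c₁ c₁' B₁' cP C₂ B₀β : ℝ) (inp : B8.B9Inputs),
        (∀ v : Site 4, 0 < len v → 1 ≤ len v) ∧ (∀ μ : Fin 4, len (e μ) = 1) ∧ 0 < B₁' ∧ 5 * ((4 : ℕ) : ℝ) * F.L * inp.B₀ ≤ B₁' ∧ 0 < c₁' ∧
        (∀ α₀ α₁ : ℝ, 0 < α₀ → 0 < α₁ → α₀ + α₁ ≤ c₁' →
          α₀ + α₁ ≤ c₁ ∧ C0 4 * (2 * α₀) ≤ 1 / 3 ∧ 4 * α₀ ≤ c2' 4 F.L ∧ 16 * (B₁' * (α₀ + α₁)) ≤ 1 ∧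
          Real.exp (4 * (800 * (((4 : ℕ) : ℝ) + 1) ^ 2 * (((4 : ℕ) : ℝ) + 4)) * α₀) * (1 + 8 * (131072 * (((4 : ℕ) : ℝ) + 1) ^ 2) * (B₁' * (α₀ + α₁))) ≤ 2 ∧
          2 * (B₁' * (α₀ + α₁)) ≤ c3 4 F.L ∧ ((4 : ℕ) : ℝ) * F.L * α₁ ≤ 1 / 8 ∧ α₀ ≤ cP ∧ α₁ ≤ cP ∧ B₁' * (α₀ + α₁) ≤ cP ∧
          2 * (B₁' * (α₀ + α₁)) ^ 2 + 20 * ((4 : ℕ) : ℝ) * α₀ * (B₁' * (α₀ + α₁)) + 2 * C₂ * (B₁' * (α₀ + α₁)) ^ 2 ≤ α₀ + α₁) ∧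
        B8.Thm4Body c₁ B₁' (fun i : {i : ZdIdx 4 F.L // (∀ j, i.Ω j = Set.univ) ∧ (∀ m j, i.Λs m j = {_y | j = m}) ∧ (∀ m j, i.Λb m j = {_c | j = m}) ∧ i.η = ((F.L : ℝ)⁻¹) ^ i.k} => (zdGF3 (Matrix (Fin 2) (Fin 2) ℂ) F.L β len i.1).toGFData) ∧
        B8.Prop3Body cP 4 (F.L : ℝ) C₂ inp B₀β (fun i : {i : ZdIdx 4 F.L // (∀ j, i.Ω j = Set.univ) ∧ (∀ m j, i.Λs m j = {_y | j = m}) ∧ (∀ m j, i.Λb m j = {_c | j = m}) ∧ i.η = ((F.L : ℝ)⁻¹) ^ i.k} => (zdGF3 (Matrix (Fin 2) (Fin 2) ℂ) F.L β len i.1).toGFData2))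
    {G : T4Family → (Site 4 → Fin 4 → (MatA 2)ˣ) → Site 4 → ℕ → ℝ → ℝ → ℝ → Prop} (hGm : ∀ F, RadiiMono 4 (G F))
    (hG : ∀ (F : T4Family) (U : Site 4 → Fin 4 → (MatA 2)ˣ) (x : Site 4) (K : ℕ) (α₀ α₁ α₂ : ℝ), 2 ≤ K → G F U x K α₀ α₁ α₂ →
      ∃ (u : Site 4 → (MatA 2)ˣ) (a : Site 4 → Fin 4 → MatA 2),
        (∀ z, u z ∈ unitaryUnits (MatA 2)) ∧
        (∀ (y : Site 4) (τ : Fin 4), l1 (y - x) ≤ 2 → ((gaugeAct u U y τ : (MatA 2)ˣ) : MatA 2) = exp (a y τ)) ∧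
        (∀ (y : Site 4) (τ : Fin 4), l1 (y - x) ≤ 2 → ‖a y τ‖ ≤ α₀) ∧
        (∀ (y : Site 4) (τ i : Fin 4), l1 (y - x) ≤ 1 → ‖fd i (fun z => a z τ) y‖ ≤ α₁) ∧
        (∀ (τ i l : Fin 4), ‖fd i (fd l (fun z => a z τ)) x‖ ≤ α₂))
    (C : T4Family → B11Thm1.Consts) (hM : ∀ (F : T4Family) (e : ℝ), 0 < e → e ≤ (C F).a₁ → 7 / 2 ≤ (C F).Mfun e)
    (hT : ∀ (F : T4Family) (k : ℕ), Thm1At (C F) (torusVP 4 F.L (ne3NperOfRecord₁₁ F 0 0) (G F) (k + 1)))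
    (h₂ : ∀ β : ℝ, 2 / 3 < β → β < 1 →
    ∀ (𝔯 : RateReading₁₃CoPH 2) (ksel : RunSel) (ℓ : LetterReading) (ℓ₃ : T4Family → Node00.NE3Letters₁₁) (g B : T4Family → ℝ),
      GuardedReadingN16 𝔯 ksel ℓ ℓ₃ g B → KeyedRatesHolderD4V β (rrOfRecord 𝔯 ksel) →
      ∃ (jc : CutReading) (sh : ShellSplit₁₃CoPH 2 0) (cr : SpineReading), PinnedAtLive jc sh cr ∧
        KeyedRelWeight cr ∧ KeyedShellWeight cr ∧ KeyedExtractionV cr ∧ KeyedCoreEdgeHolderD4V β cr (rrOfRecord 𝔯 ksel)) :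
    Summit.QuantumFields.YangMills.Theses.BalabanUVNodes.SpineGivenEndpointR13SepCoPHV :=
  spineGivenEndpointR13SepCoPHV_of_stubTextsV (stub1TextV_of_h5_thm1At_of_rows β hβ hβ' ℓ g s hs hκ hcr hρ hL h9 hW hS hg h5 hGm hG C hM hT) h₂

end Rows

end Summit.QuantumFields.YangMills.Theorems.K3V6Defs
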